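import Summits.ResolutionOfSingularities.ResolutionOfSingularities.Theorems.MaxContactCutHoleCut
import Summits.ResolutionOfSingularities.ResolutionOfSingularities.Theorems.CoefficientCutClasses
import HarnessLib

/-!
# FreezeCutConeVars — decomp-res node «FreezeCut» (lens-3 g19 rev 2, critic rows 149/149a/149b), tree file 1/5 of the node

Content VERBATIM from the decomp-res lens-3 g19 TREE-FACING COMPANION
`HOME/decomp-res-lens-3/g19/tree/FreezeCutTree.lean` (rev 3 pin
7e31fb5a…; = node `FreezeCut.lean` rev 2 pin c7927053 NEW PART ONLY; HOME = run/shared/lean/pub/decomp-res).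
Critic: CRITIC-LEDGER rows 149 / 149a /
149b CLEARED (orders 2026-08-30T22:14:37Z / 22:25:58Z / 22:27:55Z).  Landed by decomp-res writer g8 as five files
— `FreezeCutConeVars` (§V),
`FreezeCutLaw` (§F), `FreezeCutHalf` (§H) [namespace `…Theorems.HoleCut`, in-cone behind
`MaxContactCutHoleCut`], `FreezeCutClasses` (cone-free
classes of §K5/§K6; carries the full landing note and the companion description) and the wiring file
`MaxContactCutFreezeCut` — all
`--supports stmt-ResolutionOfSingularities-31770`.

§V CONE VARIABLES: the variables of the residual cone `Φ_t = in(F_t)/u^{r_t}` (`ConeVar`, `DeadSupport`,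
`TwoConeVars`, …) and their four
rules along a `HoleCut.TailShade` tail (stage law, dead successor, …).  PROVED, 0 sorry.  Namespace
`…Theorems.HoleCut` (in-cone: imports
`MaxContactCutHoleCut`).

[WRITER NOTE (decomp-res writer g8): section split only; namespaces, opens, section variables and every declaration
exactly as in the
companion (its global `linter.dupNamespace` option line dropped).]

(Sources: Hauser2010; Moh1987; CossartPiltant2008I; BenitoVillamayor2012; KawanoueMatsuki2010; HironakaBowdoin2005.)
-/

noncomputable section

open MvPolynomial Finset
open Literature.AlgebraicGeometry.Resolution
open Literature.AlgebraicGeometry.Resolution.Hauser2010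
open Literature.AlgebraicGeometry.Resolution.PointBlowup
open Summit.ResolutionOfSingularities.ResolutionOfSingularities.Theses
open Summit.ResolutionOfSingularities.ResolutionOfSingularities.Theorems.TightDefectClasses
open Summit.ResolutionOfSingularities.ResolutionOfSingularities.Theorems.TightDefectStrongWalks
open Summit.ResolutionOfSingularities.ResolutionOfSingularities.Theorems.ItineraryCutClasses
open Summit.ResolutionOfSingularities.ResolutionOfSingularities.Theorems.BoundaryLedger
open Summit.ResolutionOfSingularities.ResolutionOfSingularities.Theorems.ProximityCut
open Summit.ResolutionOfSingularities.ResolutionOfSingularities.Theorems.ConeCutAxisLaw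
open Literature.AlgebraicGeometry.Resolution.WeightedBlowup
open Literature.Barriers.ResolutionOfSingularities
open Summit.ResolutionOfSingularities.ResolutionOfSingularities.Theorems.FloorCut
open Summit.ResolutionOfSingularities.ResolutionOfSingularities.Theorems.ConeCut
open Summit.ResolutionOfSingularities.ResolutionOfSingularities.Theorems.ExitLaw (fin3_cases eq_of_le_of_degree_le)
open Summit.ResolutionOfSingularities.ResolutionOfSingularities.Theorems.ShadeCut
open Summit.ResolutionOfSingularities.ResolutionOfSingularities.Theorems.TightCut
open Summit.ResolutionOfSingularities.ResolutionOfSingularities.Theorems.HoleCut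

namespace Summit.ResolutionOfSingularities.ResolutionOfSingularities.Theorems.HoleCut

/-! ### Part 1 — §V, §F, §H: the cone-variable calculus and the two freezing laws, placed in the LANDED namespace
`…Theorems.HoleCut` (they extend the theory of `HoleCut.TailShade`; dot-notation `h.stage`, `h.dead_succ`, … resolves as in
the node).  Text byte-identical to `FreezeCut.lean` rev 2 §V/§F/§H except six `exists_third` call sites adapted to the tree's
implicit-argument signature (`ConeCutRepeats.exists_third`). -/

/-! ## §V CONE VARIABLES (g19) — the variables of the residual cone `Φ_t = in(F_t)/u^{r_t}` and their four rules

On an excess plateau of shade `n` the residual cone `Φ_t := in_{o_t}(F_t)/u^{r_t}` is a non-zero ternary form of degree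
`n` (§A–§C: its `u_{j_t}`-dehomogenisation is the residual layer `M_t = resLayer`, and `N_t = resForm = M_t(u + b_t)` is
a non-zero `u_{j_t}`-free FORM of degree `n`, `cone_of_plateau`).  The coordinate `x` is a CONE VARIABLE of stage `t`
when `u_x` occurs in `Φ_t`: some top monomial `u^d` of `F_t` (`|d| = o_t`) has `d_x > r_t(x)`.  Four rules, each a
two-line reading of the cone law: (V1) the chart of an UNTRANSLATED move — more generally of a move whose translation
fixes `M_t` — is never a cone variable (`M_t` would be a form of degree `n` with a monomial of degree `< n`);
(V2) some cone variable differs from the chart (else `M_t` is a constant, not a form of degree `n ≥ 1`); (V3) if the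
cone variables other than the chart reduce to one coordinate `k` then `b_t(k) = 0` (else `N_t = c(u_k + b_k)^n` has a
constant term); (V3′) a SINGLE translation along `z` from a chart that is a cone variable has `z` a cone variable;
(V4) PERSISTENCE: a cone variable `x ≠ j_t` is a cone variable of stage `t + 1` (`N_t` has a monomial containing
`u_x` — else `N_t = c·u_y^n` and `M_t = c(u_y − b_y)^n` is `u_x`-free — and RESTRICTION transports it to a top monomial
of `F_{t+1}` with `x`-exponent above `r_{t+1}(x)`). -/

section ConeVariables

variable {K : Type} [Field K] [DecidableEq K] {q : ℕ} {s₀ : State (Fin 3) K}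

/-- `x` is a **CONE VARIABLE** of stage `t`: a top-order monomial `u^d` of `F_t` has `d_x > r_t(x)`, i.e. `u_x` occurs
in the residual cone `in(F_t)/u^{r_t}`.  DEFINITION (support; tree letters only). -/
def ConeVar (W : ForcedWalk q s₀) (t : ℕ) (x : Fin 3) : Prop :=
  ∃ d ∈ (W.st t).F.support, ((d.degree : ℕ) : ℕ∞) = ordZero (W.st t).F ∧ (W.st t).r x < d x

/-- Two distinct cone variables at stage `t` (the residual cone is not a pure power `c·u_k^n`). DEFINITION (support). -/
def TwoConeVars (W : ForcedWalk q s₀) (t : ℕ) : Prop :=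
  ∃ x y : Fin 3, x ≠ y ∧ ConeVar W t x ∧ ConeVar W t y

/-- A **DEAD SUPPORT** at stage `t`: a cone variable of boundary multiplicity zero. DEFINITION (support). -/
def DeadSupport (W : ForcedWalk q s₀) (t : ℕ) (x : Fin 3) : Prop :=
  ConeVar W t x ∧ (W.st t).r x = 0

/-- `coneVar_iff`: Auxiliary step of this node's calculus, VERBATIM from the lens file (see the module docstring);
the statement is its type. [folklore] -/
theorem coneVar_iff (W : ForcedWalk q s₀) (t : ℕ) {o : ℕ} (ho : ordZero (W.st t).F = o) (x : Fin 3) :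
    ConeVar W t x ↔ ∃ d ∈ (W.st t).F.support, d.degree = o ∧ (W.st t).r x < d x := by
  unfold ConeVar
  rw [ho]
  constructor
  · rintro ⟨d, hd, hdeg, hlt⟩
    exact ⟨d, hd, by exact_mod_cast hdeg, hlt⟩
  · rintro ⟨d, hd, hdeg, hlt⟩
    exact ⟨d, hd, by exact_mod_cast hdeg, hlt⟩

omit [DecidableEq K] in
/-- A monomial of the residual layer comes from a top monomial of `F`. [folklore] -/
theorem exists_top_of_coeff_resLayer_ne_zero (j : Fin 3) (s : State (Fin 3) K) (o : ℕ) {E : Fin 3 →₀ ℕ}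
    (hE : coeff E (resLayer j s o) ≠ 0) : ∃ d ∈ s.F.support, d.degree = o ∧ E = (d - s.r).update j 0 := by
  classical
  unfold resLayer at hE
  rw [coeff_sum] at hE
  obtain ⟨d, hd, hne⟩ := Finset.exists_ne_zero_of_sum_ne_zero hE
  rw [coeff_monomial] at hne
  split_ifs at hne with heq
  · obtain ⟨hdF, hdo⟩ := Finset.mem_filter.mp hd
    exact ⟨d, hdF, hdo, heq.symm⟩
  · exact absurd rfl hne

/-- DICTIONARY (off the chart): `x ≠ j_t` is a cone variable iff some monomial of the residual layer `M_t` involves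
`u_x`. [folklore] -/
theorem coneVar_iff_resLayer (hroot : IsRoot q s₀) (W : ForcedWalk q s₀) (t : ℕ) {o : ℕ}
    (ho : ordZero (W.st t).F = o) {x : Fin 3} (hx : x ≠ W.j t) :
    ConeVar W t x ↔ ∃ E, coeff E (resLayer (W.j t) (W.st t) o) ≠ 0 ∧ E x ≠ 0 := by
  classical
  rw [coneVar_iff W t ho]
  constructor
  · rintro ⟨d, hd, hdeg, hlt⟩
    have hrd : (W.st t).r ≤ d := walk_r hroot W t d hd
    have hm : (d - (W.st t).r).degree + (W.st t).r.degree = o := by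
      rw [← map_add, tsub_add_cancel_of_le hrd]; exact hdeg
    refine ⟨(d - (W.st t).r).update (W.j t) 0, ?_, ?_⟩
    · rw [coeff_resLayer (W.j t) (W.st t) (walk_r hroot W t) o _ hm, add_tsub_cancel_of_le hrd]
      exact mem_support_iff.mp hd
    · rw [update_apply', if_neg hx, Finsupp.tsub_apply]
      omega
  · rintro ⟨E, hE, hEx⟩
    obtain ⟨d, hd, hdeg, rfl⟩ := exists_top_of_coeff_resLayer_ne_zero (W.j t) (W.st t) o hE
    refine ⟨d, hd, hdeg, ?_⟩
    rw [update_apply', if_neg hx, Finsupp.tsub_apply] at hEx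
    omega

/-- DICTIONARY (at the chart): the chart `j_t` is a cone variable iff the residual layer `M_t` (dehomogenised at
`u_{j_t}`) has a monomial of degree `< n = o_t − |r_t|`. [folklore] -/
theorem coneVar_chart_iff_resLayer (hroot : IsRoot q s₀) (W : ForcedWalk q s₀) (t : ℕ) {o : ℕ}
    (ho : ordZero (W.st t).F = o) {n : ℕ} (hon : o = n + (W.st t).r.degree) :
    ConeVar W t (W.j t) ↔ ∃ E, coeff E (resLayer (W.j t) (W.st t) o) ≠ 0 ∧ E.degree < n := by
  classical
  rw [coneVar_iff W t ho]
  constructor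
  · rintro ⟨d, hd, hdeg, hlt⟩
    have hrd : (W.st t).r ≤ d := walk_r hroot W t d hd
    have hm : (d - (W.st t).r).degree + (W.st t).r.degree = o := by
      rw [← map_add, tsub_add_cancel_of_le hrd]; exact hdeg
    refine ⟨(d - (W.st t).r).update (W.j t) 0, ?_, ?_⟩
    · rw [coeff_resLayer (W.j t) (W.st t) (walk_r hroot W t) o _ hm, add_tsub_cancel_of_le hrd]
      exact mem_support_iff.mp hd
    · have h2 := degree_update_add (d - (W.st t).r) (W.j t) 0
      have h4 : (d - (W.st t).r) (W.j t) = d (W.j t) - (W.st t).r (W.j t) := Finsupp.tsub_apply _ _ _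
      omega
  · rintro ⟨E, hE, hEd⟩
    obtain ⟨d, hd, hdeg, rfl⟩ := exists_top_of_coeff_resLayer_ne_zero (W.j t) (W.st t) o hE
    have hrd : (W.st t).r ≤ d := walk_r hroot W t d hd
    have hm : (d - (W.st t).r).degree + (W.st t).r.degree = o := by
      rw [← map_add, tsub_add_cancel_of_le hrd]; exact hdeg
    refine ⟨d, hd, hdeg, ?_⟩
    have h2 := degree_update_add (d - (W.st t).r) (W.j t) 0
    have h4 : (d - (W.st t).r) (W.j t) = d (W.j t) - (W.st t).r (W.j t) := Finsupp.tsub_apply _ _ _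
    have h5 := Finsupp.le_def.mp hrd (W.j t)
    omega

omit [DecidableEq K] in
/-- A translation vanishing at every variable that occurs in `P` fixes `P`. [folklore] -/
theorem translate_eq_self_of_vanish (b : Fin 3 → K) (P : MvPolynomial (Fin 3) K)
    (h : ∀ E ∈ P.support, ∀ l, E l ≠ 0 → b l = 0) : translate b P = P := by
  classical
  conv_lhs => rw [P.as_sum, translate_finset_sum]
  conv_rhs => rw [P.as_sum]
  refine Finset.sum_congr rfl fun E hE => ?_
  rw [← mul_one (coeff E P), ← C_mul_monomial, translate_C_mul, translate_monomial_eq_self b E (h E hE)]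

/-- The translation of move `t` fixes the residual layer as soon as it vanishes at every cone variable. [folklore] -/
theorem translate_resLayer_eq_self (hroot : IsRoot q s₀) (W : ForcedWalk q s₀) (t : ℕ) {o : ℕ}
    (ho : ordZero (W.st t).F = o) (hvan : ∀ z, W.b t z ≠ 0 → ¬ ConeVar W t z) :
    translate (W.b t) (resLayer (W.j t) (W.st t) o) = resLayer (W.j t) (W.st t) o := by
  classical
  refine translate_eq_self_of_vanish _ _ fun E hE l hl => ?_
  by_contra hb
  have hlj : l ≠ W.j t := fun h' => hb (by rw [h']; exact W.onExc t)
  exact hvan l hb ((coneVar_iff_resLayer hroot W t ho hlj).mpr ⟨E, mem_support_iff.mp hE, hl⟩)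

/-- **(V1) (PROVED)** On a plateau step, if the translation of move `t` fixes the residual layer then the chart is NOT
a cone variable: the layer is then the residual FORM, homogeneous of degree `n`, while a chart cone variable is a monomial
of degree `< n`. [new] [folklore] -/
theorem not_coneVar_chart_of_translate_eq (hroot : IsRoot q s₀) (W : ForcedWalk q s₀) (t : ℕ) {o : ℕ}
    (ho : ordZero (W.st t).F = o) (hqo : q < o) (hplat : (W.st (t + 1)).shade = (W.st t).shade) {n : ℕ}
    (hn : (W.st t).shade = (n : ℕ∞))
    (hfix : translate (W.b t) (resLayer (W.j t) (W.st t) o) = resLayer (W.j t) (W.st t) o) :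
    ¬ ConeVar W t (W.j t) := by
  classical
  obtain ⟨hhom, -⟩ := cone_of_plateau hroot W t ho hqo hplat hn
  have hon : o = n + (W.st t).r.degree := order_eq_of_plateau hroot W ho hn
  rw [coneVar_chart_iff_resLayer hroot W t ho hon]
  rintro ⟨E, hE, hEd⟩
  have hhom' : (resLayer (W.j t) (W.st t) o).IsHomogeneous n := by
    have h := hhom
    unfold resForm at h
    rwa [hfix] at h
  exact hE (hhom'.coeff_eq_zero (by omega))

/-- **(V1) UNTRANSLATED MOVES NEVER CHART A CONE VARIABLE (PROVED).** [new] [folklore] -/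
theorem not_coneVar_chart_of_untranslated (hroot : IsRoot q s₀) (W : ForcedWalk q s₀) (t : ℕ) {o : ℕ}
    (ho : ordZero (W.st t).F = o) (hqo : q < o) (hplat : (W.st (t + 1)).shade = (W.st t).shade) {n : ℕ}
    (hn : (W.st t).shade = (n : ℕ∞)) (hb : W.b t = 0) : ¬ ConeVar W t (W.j t) :=
  not_coneVar_chart_of_translate_eq hroot W t ho hqo hplat hn (by rw [hb, translate_zero_eq])

/-- **(V3′) SINGLE TRANSLATIONS (PROVED)**: if move `t` translates along `z` only and its chart is a cone variable,
then `z` is a cone variable (else the translation fixes the layer and (V1) applies). [new] [folklore] -/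
theorem coneVar_of_single_translation (hroot : IsRoot q s₀) (W : ForcedWalk q s₀) (t : ℕ) {o : ℕ}
    (ho : ordZero (W.st t).F = o) (hqo : q < o) (hplat : (W.st (t + 1)).shade = (W.st t).shade) {n : ℕ}
    (hn : (W.st t).shade = (n : ℕ∞)) {z : Fin 3} (hby : ∀ y, y ≠ z → W.b t y = 0)
    (hj : ConeVar W t (W.j t)) : ConeVar W t z := by
  by_contra hz
  refine not_coneVar_chart_of_translate_eq hroot W t ho hqo hplat hn ?_ hj
  refine translate_resLayer_eq_self hroot W t ho fun l hl => ?_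
  have hlz : l = z := by
    by_contra h'
    exact hl (hby l h')
  rw [hlz]
  exact hz

/-- **(V2) SOME CONE VARIABLE DIFFERS FROM THE CHART (PROVED)**: otherwise the residual layer is a non-zero constant,
fixed by the translation, and a form of degree `n ≥ 1`. [new] [folklore] -/
theorem exists_coneVar_ne_chart (hroot : IsRoot q s₀) (W : ForcedWalk q s₀) (t : ℕ) {o : ℕ}
    (ho : ordZero (W.st t).F = o) (hqo : q < o) (hplat : (W.st (t + 1)).shade = (W.st t).shade) {n : ℕ}
    (hn : (W.st t).shade = (n : ℕ∞)) (hn1 : 1 ≤ n) : ∃ x, x ≠ W.j t ∧ ConeVar W t x := by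
  classical
  by_contra hno
  push Not at hno
  obtain ⟨hhom, -⟩ := cone_of_plateau hroot W t ho hqo hplat hn
  have hE0 : ∀ E ∈ (resLayer (W.j t) (W.st t) o).support, E = 0 := by
    intro E hE
    ext l
    rw [Finsupp.coe_zero, Pi.zero_apply]
    by_contra hl
    by_cases hlj : l = W.j t
    · exact (mem_support_iff.mp hE) (coeff_resLayer_eq_zero_of_ne (W.j t) (W.st t) o (E := E) (by rw [← hlj]; exact hl))
    · exact hno l hlj ((coneVar_iff_resLayer hroot W t ho hlj).mpr ⟨E, mem_support_iff.mp hE, hl⟩)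
  have hfix : translate (W.b t) (resLayer (W.j t) (W.st t) o) = resLayer (W.j t) (W.st t) o :=
    translate_eq_self_of_vanish _ _ fun E hE l hl => by
      rw [hE0 E hE, Finsupp.coe_zero, Pi.zero_apply] at hl
      exact absurd rfl hl
  have hhom' : (resLayer (W.j t) (W.st t) o).IsHomogeneous n := by
    have h := hhom
    unfold resForm at h
    rwa [hfix] at h
  have hR0 : resLayer (W.j t) (W.st t) o ≠ 0 := resLayer_ne_zero (W.j t) (W.st t) (walk_r hroot W t) ho
  obtain ⟨E, hE⟩ := MvPolynomial.ne_zero_iff.mp hR0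
  have hE' := hE0 E (mem_support_iff.mpr hE)
  refine hE (hhom'.coeff_eq_zero ?_)
  rw [hE', map_zero]
  omega

/-- **(V3) A LONE CONE VARIABLE IS NOT TRANSLATED (PROVED)**: if every cone variable is the coordinate `k ≠ j_t`, then
`b_t(k) = 0` — else `M_t = c·u_k^n` and `N_t = c(u_k + b_k)^n` has the constant term `c·b_k^n ≠ 0`, not a form of
degree `n ≥ 1`. [new] [folklore] -/
theorem b_eq_zero_of_coneVar_subset (hroot : IsRoot q s₀) (W : ForcedWalk q s₀) (t : ℕ) {o : ℕ}
    (ho : ordZero (W.st t).F = o) (hqo : q < o) (hplat : (W.st (t + 1)).shade = (W.st t).shade) {n : ℕ}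
    (hn : (W.st t).shade = (n : ℕ∞)) (hn1 : 1 ≤ n) {k : Fin 3} (hk : k ≠ W.j t)
    (honly : ∀ x, ConeVar W t x → x = k) : W.b t k = 0 := by
  classical
  by_contra hbk
  obtain ⟨hhom, -⟩ := cone_of_plateau hroot W t ho hqo hplat hn
  have hon : o = n + (W.st t).r.degree := order_eq_of_plateau hroot W ho hn
  obtain ⟨y, hyj, hyk⟩ := exists_third hk.symm
  -- every monomial of the residual layer is `n·e_k`
  have hE0 : ∀ E ∈ (resLayer (W.j t) (W.st t) o).support, E = Finsupp.single k n := by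
    intro E hE
    obtain ⟨d, hd, hdeg, rfl⟩ := exists_top_of_coeff_resLayer_ne_zero (W.j t) (W.st t) o (mem_support_iff.mp hE)
    have hrd : (W.st t).r ≤ d := walk_r hroot W t d hd
    have hsum : (d - (W.st t).r).degree + (W.st t).r.degree = d.degree := by
      rw [← map_add, tsub_add_cancel_of_le hrd]
    have hz : ∀ l, l ≠ k → (d - (W.st t).r) l = 0 := by
      intro l hl
      rw [Finsupp.tsub_apply]
      by_contra hne
      exact hl (honly l ((coneVar_iff W t ho l).mpr ⟨d, hd, hdeg, by omega⟩))
    have h3 := degree_eq_three (d - (W.st t).r) hk.symm hyj hyk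
    have hjz := hz (W.j t) hk.symm
    have hyz := hz y hyk
    ext l
    rw [update_apply', Finsupp.single_apply]
    by_cases hlj : l = W.j t
    · rw [if_pos hlj, if_neg (fun h' => hk (h'.trans hlj))]
    · rw [if_neg hlj]
      by_cases hkl : k = l
      · rw [if_pos hkl, ← hkl]
        omega
      · rw [if_neg hkl]
        exact hz l (Ne.symm hkl)
  have hR0 : resLayer (W.j t) (W.st t) o ≠ 0 := resLayer_ne_zero (W.j t) (W.st t) (walk_r hroot W t) ho
  have hsupp : (resLayer (W.j t) (W.st t) o).support = {Finsupp.single k n} := by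
    refine Finset.eq_singleton_iff_unique_mem.mpr ⟨?_, hE0⟩
    obtain ⟨E, hE⟩ := MvPolynomial.ne_zero_iff.mp hR0
    have h' := hE0 E (mem_support_iff.mpr hE)
    rw [← h']
    exact mem_support_iff.mpr hE
  have hc : coeff (Finsupp.single k n) (resLayer (W.j t) (W.st t) o) ≠ 0 :=
    mem_support_iff.mp (by rw [hsupp]; exact Finset.mem_singleton_self _)
  -- the constant term of the residual form is `c · b_k^n`
  have hc0 : coeff 0 (resForm W t o) = coeff (Finsupp.single k n) (resLayer (W.j t) (W.st t) o) * W.b t k ^ n := by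
    unfold resForm
    rw [coeff_translate_eq_sum, hsupp, Finset.sum_singleton]
    congr 1
    rw [Fintype.prod_eq_single k (fun x hx => by simp [Ne.symm hx])]
    simp
  have hzero : coeff 0 (resForm W t o) = 0 := hhom.coeff_eq_zero (by rw [map_zero]; omega)
  rw [hzero] at hc0
  exact (mul_ne_zero hc (pow_ne_zero _ hbk)) hc0.symm

/-- **(V4) PERSISTENCE (PROVED)**: on a plateau step a cone variable `x ≠ j_t` is a cone variable of stage `t +
1`. [new] [folklore] -/
theorem coneVar_succ (hroot : IsRoot q s₀) (W : ForcedWalk q s₀) (t : ℕ) {o : ℕ}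
    (ho : ordZero (W.st t).F = o) (hqo : q < o) (hplat : (W.st (t + 1)).shade = (W.st t).shade) {n : ℕ}
    (hn : (W.st t).shade = (n : ℕ∞)) {x : Fin 3} (hx : x ≠ W.j t) (hcx : ConeVar W t x) :
    ConeVar W (t + 1) x := by
  classical
  obtain ⟨hhom, hne⟩ := cone_of_plateau hroot W t ho hqo hplat hn
  -- Step 1: the residual form has a monomial involving `u_x`
  have hm : ∃ m, coeff m (resForm W t o) ≠ 0 ∧ m x ≠ 0 := by
    by_contra hno
    push Not at hno
    obtain ⟨y, hyj, hyx⟩ := exists_third hx.symm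
    have hE0 : ∀ m ∈ (resForm W t o).support, m = Finsupp.single y n := by
      intro m hmN
      have hc := mem_support_iff.mp hmN
      have hmj : m (W.j t) = 0 := by
        by_contra h'
        exact hc (coeff_resForm_eq_zero W t o h')
      have hmx : m x = 0 := hno m hc
      have hmd : m.degree = n := by
        by_contra h'
        exact hc (hhom.coeff_eq_zero h')
      have h3 := degree_eq_three m hx.symm hyj hyx
      ext l
      rw [Finsupp.single_apply]
      by_cases hly : y = l
      · rw [if_pos hly, ← hly]
        omega
      · rw [if_neg hly]
        rcases fin3_cases hx.symm hyj hyx l with hl | hl | hl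
        · rw [hl]; exact hmj
        · rw [hl]; exact hmx
        · exact absurd hl.symm hly
    have hR : resLayer (W.j t) (W.st t) o = translate (fun i => -W.b t i) (resForm W t o) := by
      unfold resForm
      rw [JumpCut.translate_translate]
      have h0 : (fun i => W.b t i + -W.b t i) = (0 : Fin 3 → K) := by
        funext i
        simp
      rw [h0, translate_zero_eq]
    obtain ⟨D, hD, hDx⟩ := (coneVar_iff_resLayer hroot W t ho hx).mp hcx
    rw [hR, coeff_translate_eq_sum] at hD
    apply hD
    refine Finset.sum_eq_zero fun m hmN => ?_
    rw [hE0 m hmN]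
    refine mul_eq_zero_of_right _ (Finset.prod_eq_zero (Finset.mem_univ x) ?_)
    have hsx : (Finsupp.single y n) x = 0 := by rw [Finsupp.single_apply, if_neg hyx]
    rw [hsx, Nat.choose_eq_zero_of_lt (Nat.pos_of_ne_zero hDx), Nat.cast_zero, zero_mul]
  -- Step 2: RESTRICTION transports it to a top monomial of `F_{t+1}`
  obtain ⟨m, hmc, hmx⟩ := hm
  have hmj : m (W.j t) = 0 := by
    by_contra h'
    exact hmc (coeff_resForm_eq_zero W t o h')
  have hmd : m.degree = n := by
    by_contra h'
    exact hmc (hhom.coeff_eq_zero h')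
  have hrest := restriction_of_plateau hroot W t ho hqo hplat hn m hmj hmd
  obtain ⟨o', ho', -⟩ := walk_nat hroot W (t + 1)
  have hn' : (W.st (t + 1)).shade = (n : ℕ∞) := by rw [hplat, hn]
  have hon' : o' = n + (W.st (t + 1)).r.degree := order_eq_of_plateau hroot W ho' hn'
  rw [coneVar_iff W (t + 1) ho']
  refine ⟨(W.st (t + 1)).r + m, ?_, ?_, ?_⟩
  · rw [mem_support_iff, hrest]
    exact mul_ne_zero (bUnit_ne_zero W t) hmc
  · rw [map_add, hmd]
    omega
  · rw [Finsupp.add_apply]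
    omega

end ConeVariables

end Summit.ResolutionOfSingularities.ResolutionOfSingularities.Theorems.HoleCut
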